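import Summits.Ventures.HodgeRepro.CosetQuadExists

/-!
# The involution-rectangle mechanism at its first level: `Δ = {1, u, v, uv}`, `u` an involution, `v` of order `6`

Blind re-derivation cell `pub-hodge-repro`, seat `p1` (gen 10).  A FOURTH mechanism for single-class `SumTwo`
quadruples without a conjugate pair, found by the gen-10 abelian census: on `C₂ × C₁₂` with `c = (0, 6)` — a pair
`(G, c)` in which NO subgroup of order `4` avoids `c` and no cyclic quotient `ℤ/2rpq` exists, so none of the three
mechanisms known so far (cyclic coset, Klein coset, cyclic recipe) applies — the RECTANGLE `Δ = {0, u, v, u + v}`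
with `u = (1, 0)` an involution and `v = (0, 2)` of order `6` (`3v = c`) carries an instance.  The `SumTwo`
condition lives on `W = ⟨u, v⟩ ≅ C₂ × C₆` (`c = 3v ∈ W`), and two local solutions on `W` with DISJOINT bad sets
exist: the induced type `C₂ × {odd}` (a conjugate pair only through `v`, `u + v`, `u − v`) and a `u`-antisymmetric
type `{x : f(x + u) = 1 − f(x)}` with a non-alternating trace on `⟨v⟩` (a conjugate pair only through `u`); so TWO
cosets of `W` suffice, i.e. `|G| ≥ 24`.  (For `v` of order `2k` the same works iff `k` is ODD: for even `k` every
local solution is `u`-antisymmetric.)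

This file is the `k = 3` level, by `decide` on `P = ℤ/2 × ℤ/3 × ℤ/2` (CRT coordinates `C₆ ≅ C₃ × C₂`;
`u = (1, 0, 0)`, `w = (0, 1, 0)` of order `3`, `c = (0, 0, 1)`, `v = wc = (0, 1, 1)` of order `6`) through the
generic theorem `exists_quad_of_pattern` of `CosetQuadExists.lean`:

* `exists_rectQuad6`: for every finite `(G, c)`, every involution `u ∉ {1, c}` and every `w` of order `3`
  commuting with `u`, if `24 ≤ |G|` then some CM type `Φ` has `Φ, Φu, Φ(wc), Φ(uwc)` `SumTwo` without a conjugate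
  pair.

Instances beyond the three old mechanisms: `(C₂ × C₁₂, (0, 6))`, `(C₂ × C₃₀, (0, 15))`, `(C₂₄ × C₂, (12, 0))`,
`(C₁₈ × C₂, every c)`, `(C₆ × C₆, every c)` — every abelian `(G, c)` with a second involution `u ≠ c` and an
element of order `3`, once `|G| ≥ 24`.
-/

set_option autoImplicit false

open Finset
open scoped Pointwise

namespace HodgeRepro.CosetQuad

variable {G : Type*} [Group G]

/-- The abstract group `ℤ/2 × ℤ/3 × ℤ/2` of the involution-rectangle mechanism at `k = 3`. -/
abbrev P12 : Type := Multiplicative (ZMod 2) × (Multiplicative (ZMod 3) × Multiplicative (ZMod 2))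

/-- The hom `ℤ/2 × ℤ/3 × ℤ/2 →* G`, `(i, a, e) ↦ uⁱ wᵃ cᵉ`, for a complex conjugation `c`, an involution `u`
commuting with `w`, and `w` of order `3`. -/
def rectHom6 {c : G} (hc : IsComplexConj c) {u w : G} (hu : u * u = 1) (hw : orderOf w = 3)
    (huw : u * w = w * u) : P12 →* G :=
  (zmodPowHom 2 u (by rw [pow_two, hu])).noncommCoprod
    ((zmodPowHom 3 w (by rw [← hw, pow_orderOf_eq_one])).noncommCoprod (zmodPowHom 2 c (conj_sq_eq_one hc))
      fun _ _ => Commute.pow_pow (hc.comm w).symm _ _)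
    fun _ _ => Commute.mul_right (Commute.pow_pow huw _ _) (Commute.pow_pow (hc.comm u).symm _ _)

/-- `(1 : ℤ/3).val = 1`. -/
theorem val_one_three : (1 : ZMod 3).val = 1 := rfl

/-- `rectHom6 (i, a, e) = uⁱ wᵃ cᵉ`. -/
theorem rectHom6_apply {c : G} (hc : IsComplexConj c) {u w : G} (hu : u * u = 1) (hw : orderOf w = 3)
    (huw : u * w = w * u) (p : P12) :
    rectHom6 hc hu hw huw p = u ^ (Multiplicative.toAdd p.1).val *
      (w ^ (Multiplicative.toAdd p.2.1).val * c ^ (Multiplicative.toAdd p.2.2).val) := rfl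

/-- `rectHom6` is injective when `u ∉ {1, c}`: squaring `uⁱ wᵃ cᵉ = 1` gives `w^{2a} = 1`, so `a = 0` (`w` has
odd order), and then `uⁱ cᵉ = 1` forces `i = e = 0`. -/
theorem rectHom6_injective {c : G} (hc : IsComplexConj c) {u w : G} (hu : u * u = 1) (hw : orderOf w = 3)
    (huw : u * w = w * u) (hu1 : u ≠ 1) (huc : u ≠ c) : Function.Injective (rectHom6 hc hu hw huw) := by
  rw [injective_iff_map_eq_one]
  rintro ⟨i, a, e⟩ hp
  rw [rectHom6_apply] at hp
  dsimp only at hp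
  have hi2 := ZMod.val_lt (Multiplicative.toAdd i)
  have ha3 := ZMod.val_lt (Multiplicative.toAdd a)
  have he2 := ZMod.val_lt (Multiplicative.toAdd e)
  set I := (Multiplicative.toAdd i).val with hI
  set A := (Multiplicative.toAdd a).val with hA
  set E := (Multiplicative.toAdd e).val with hE
  -- squaring
  have hcomm1 : Commute (u ^ I) (w ^ A * c ^ E) :=
    Commute.mul_right (Commute.pow_pow huw _ _) (Commute.pow_pow (hc.comm u).symm _ _)
  have hcomm2 : Commute (w ^ A) (c ^ E) := Commute.pow_pow (hc.comm w).symm _ _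
  have hsq : w ^ (2 * A) = 1 := by
    have h : (u ^ I * (w ^ A * c ^ E)) ^ 2 = 1 := by rw [hp, one_pow]
    rw [hcomm1.mul_pow, hcomm2.mul_pow, ← pow_mul, ← pow_mul, ← pow_mul, mul_comm I 2, pow_mul u 2 I,
      pow_two u, hu, one_pow, one_mul, mul_comm E 2, pow_mul c 2 E, pow_two c, hc.mul_self, one_pow,
      mul_one, mul_comm A 2] at h
    exact h
  have hdvd : orderOf w ∣ 2 * A := orderOf_dvd_of_pow_eq_one hsq
  rw [hw] at hdvd
  have hA0 : A = 0 := by omega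
  rw [hA0, pow_zero, one_mul] at hp
  have key : I = 0 ∧ E = 0 := by
    have hiv : I = 0 ∨ I = 1 := by omega
    have hev : E = 0 ∨ E = 1 := by omega
    rcases hiv with hi | hi <;> rcases hev with he | he <;> rw [hi, he] at hp <;>
      simp only [pow_zero, pow_one, one_mul, mul_one] at hp
    · exact ⟨hi, he⟩
    · exact absurd hp hc.ne_one
    · exact absurd hp hu1
    · exact absurd ((eq_inv_of_mul_eq_one_left hp).trans hc.inv_eq) huc
  have hi : i = 1 := by
    rw [← ofAdd_toAdd i, (ZMod.val_eq_zero _).1 key.1, ofAdd_zero]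
  have ha : a = 1 := by
    rw [← ofAdd_toAdd a, (ZMod.val_eq_zero _).1 hA0, ofAdd_zero]
  have he : e = 1 := by
    rw [← ofAdd_toAdd e, (ZMod.val_eq_zero _).1 key.2, ofAdd_zero]
  rw [hi, ha, he]
  rfl

/-- The twists `1, (1,0,0), (0,1,1), (1,1,1)`, mapped to `1, u, wc, uwc`. -/
def rectTwist6 (i : Fin 4) : P12 :=
  ![(1, 1, 1), (Multiplicative.ofAdd 1, 1, 1), (1, Multiplicative.ofAdd 1, Multiplicative.ofAdd 1),
    (Multiplicative.ofAdd 1, Multiplicative.ofAdd 1, Multiplicative.ofAdd 1)] i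

/-- The element `(0, 0, 1)` of `P12`, mapped to `c`. -/
def rectConj6 : P12 := (1, 1, Multiplicative.ofAdd 1)

/-- `rectHom6 rectConj6 = c`. -/
theorem rectHom6_conj {c : G} (hc : IsComplexConj c) {u w : G} (hu : u * u = 1) (hw : orderOf w = 3)
    (huw : u * w = w * u) : rectHom6 hc hu hw huw rectConj6 = c := by
  rw [rectHom6_apply]
  show u ^ (0 : ZMod 2).val * (w ^ (0 : ZMod 3).val * c ^ (1 : ZMod 2).val) = c
  simp only [ZMod.val_zero, val_one_two, pow_zero, pow_one, one_mul]

/-- The quadruple `Φ, Φu, Φ(wc), Φ(uwc)`. -/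
def rectQuad (Φ : Finset G) (u w c : G) : Fin 4 → Finset G :=
  ![Φ, rmul Φ u, rmul Φ (w * c), rmul Φ (u * (w * c))]

/-- `rectQuad Φ u w c` is the quadruple of twists by the `rectHom6 (rectTwist6 i)`. -/
theorem rectQuad_eq_twists (Φ : Finset G) {c : G} (hc : IsComplexConj c) {u w : G} (hu : u * u = 1)
    (hw : orderOf w = 3) (huw : u * w = w * u) :
    rectQuad Φ u w c = fun i => rmul Φ (rectHom6 hc hu hw huw (rectTwist6 i)) := by
  funext i
  rw [rectHom6_apply]
  fin_cases i
  · show Φ = rmul Φ (u ^ (0 : ZMod 2).val * (w ^ (0 : ZMod 3).val * c ^ (0 : ZMod 2).val))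
    simp only [ZMod.val_zero, pow_zero, one_mul, rmul_one]
  · show rmul Φ u = rmul Φ (u ^ (1 : ZMod 2).val * (w ^ (0 : ZMod 3).val * c ^ (0 : ZMod 2).val))
    simp only [ZMod.val_zero, val_one_two, pow_zero, pow_one, mul_one]
  · show rmul Φ (w * c) =
      rmul Φ (u ^ (0 : ZMod 2).val * (w ^ (1 : ZMod 3).val * c ^ (1 : ZMod 2).val))
    simp only [ZMod.val_zero, val_one_two, val_one_three, pow_zero, pow_one, one_mul]
  · show rmul Φ (u * (w * c)) =
      rmul Φ (u ^ (1 : ZMod 2).val * (w ^ (1 : ZMod 3).val * c ^ (1 : ZMod 2).val))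
    simp only [val_one_two, val_one_three, pow_one]

/-- The two local solutions on `W = ℤ/2 × ℤ/3 × ℤ/2` as a pattern.  Label `0` (type A, `u`-antisymmetric with
a non-alternating trace on `⟨v⟩`): `[i = 1] ⊕ [e = 1] ⊕ [a = 0]`; label `1` (type B, the induced type
`C₂ × {odd}`): `[e = 1]`.  Type A is stable under `uc` only, type B under `vc`, `uvc`, `u v⁻¹ c` only. -/
def rectPattern6 (l : Fin 2) (p : P12) : Bool :=
  if l = 0 then
    xor (xor (decide (Multiplicative.toAdd p.1 = 1)) (decide (Multiplicative.toAdd p.2.2 = 1)))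
      (decide (Multiplicative.toAdd p.2.1 = 0))
  else decide (Multiplicative.toAdd p.2.2 = 1)

/-- **The involution-rectangle mechanism at `k = 3` exists from degree `24` on.**  For every finite `(G, c)`,
every involution `u ∉ {1, c}` and every `w` of order `3` commuting with `u`: if `24 ≤ |G|`, some CM type `Φ` has
`Φ, Φu, Φ(wc), Φ(uwc)` `SumTwo` without a conjugate pair (`v = wc` has order `6`, `v³ = c`, and
`Δ = {1, u, v, uv}` is a coset of no subgroup). -/
theorem exists_rectQuad6 [Fintype G] [DecidableEq G] {c : G} (hc : IsComplexConj c) {u w : G}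
    (hu : u * u = 1) (hw : orderOf w = 3) (huw : u * w = w * u) (hu1 : u ≠ 1) (huc : u ≠ c)
    (hG : 24 ≤ Fintype.card G) :
    ∃ Φ : Finset G, IsCMType c Φ ∧ SumTwo (rectQuad Φ u w c) ∧
      ∀ i j : Fin 4, rectQuad Φ u w c j ≠ c • rectQuad Φ u w c i := by
  have hcard : Fintype.card (Fin 2) * Fintype.card P12 ≤ Fintype.card G := by
    rw [Fintype.card_fin, show Fintype.card P12 = 12 from rfl]
    exact hG
  obtain ⟨Φ, h1, h2, h3⟩ := exists_quad_of_pattern (rectHom6 hc hu hw huw)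
    (rectHom6_injective hc hu hw huw hu1 huc) hc (rectHom6_conj hc hu hw huw)
    rectTwist6 rectPattern6 (by decide) (by decide) (by decide) hcard
  refine ⟨Φ, h1, ?_, ?_⟩
  · rw [rectQuad_eq_twists Φ hc hu hw huw]; exact h2
  · rw [rectQuad_eq_twists Φ hc hu hw huw]; exact h3

end HodgeRepro.CosetQuad
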